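import Summits.BirchSwinnertonDyer.BirchSwinnertonDyer.Theorems.EisensteinPrimesMazurMCOnCellBOfNamedFactsV11
import HarnessLib

/-!
# Crux 3 `MazurMCOnCellB` (stmt-BirchSwinnertonDyer-19033), line `twistback` v11 — THE REGISTERED OPEN CONTENT IS TWO SUPPLY
# STATEMENTS: the v11 stub 6⁶ follows (vacuously) from «SUPPLY-e: every SPLIT X2b pair is connected to a Ш-unit class» and
# «SUPPLY-b: every NON-split X2b pair off the sub-row is connected to a Ш-unit class or to an order-one anchor», and so
# crux 3 BY NAME follows from the named facts + these two supplies

LEAD bsd-line-x2-p1 (gen 15), cell `bsd-eis`, 2026-08-28; `--supports stmt-BirchSwinnertonDyer-19033 --as helper`; companion of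
p677789 `…OfNamedFactsV11`. THEOREMS ONLY: no `def`, no named fact introduced, no `sorry`. HONEST FRAMING: this file proves NO
supply statement — both are OPEN in print and appear here as HYPOTHESES (`hSe`, `hSb`), spelled out inline (no `def`); it is
the kernel record of the LEAD g15 verdict's sentence «the registered open content after v11 = X2b pairs off the sub-row whose
component contains no Ш-unit class and no order-one anchor», i.e. `## Census / What is missing` as Lean signatures. No summit
statement, no Mazur main conjecture and no case of BSD is proved for any curve; 0 cells / labels / stubs / tiers move.

## What

* §1 `stub66_of_supplies` — SUPPLY-e ∧ SUPPLY-b ⟹ the v11 registered stub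
  `stub_upperPartnerOffSubrowNoConnectedClassShaUnitNoOrderOneAnchor` (statement VERBATIM): at a pair satisfying the stub's
  three negated hypotheses the supplies are contradicted, split or not (excluded middle on the sign at `p`), so the
  ∃-PARTNER conclusion holds vacuously. Fact-free.
* §2 `mazurMCOnCellB_of_namedFacts_of_supplies` — CRUX 3 BY NAME from `PublishedInputs` + the EIGHT PUBLISHED named facts of
  `stub_printedFacts` + Keller–Yin Thm. D (PRE) + SUPPLY-e + SUPPLY-b (p677789 ∘ §1): the class-wide residual of the line in ONE
  conditional theorem. SUPPLY-e = idea-12's `UnitAnchorSupply` in connected form (road (e); presearch LEAD g14/g15: Vatsal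
  1999/2005, Kriz–Li 2019, Byeon, James 1999 — none at `p ∣ N` with even twists); SUPPLY-b ⊇ Schneider's conjecture at ONE
  admissible partner of ONE vertex per non-split component (road (b); presearch LEAD g15: none; Bertrand 1982 CM only).

References: [Wuthrich2014] Prop. 21; [Schneider1985] §1; [PerrinRiou1987] §1.4; [Disegni2020] §2.2 Thm. 2.4, §3.2 Thm. 4;
[KellerYin2024] Thm. D (= Thm. 5.1.3); [GreenbergVatsal2000] §3 Thm. (3.11); tree: p675388, p677789, p671590, p661229.
-/

set_option autoImplicit false

-- `Summit.BirchSwinnertonDyer.BirchSwinnertonDyer.…`: the summit and its single sub-problem share a name.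
set_option linter.dupNamespace false

noncomputable section

open scoped Classical MatrixGroups ModularForm

open CongruenceSubgroup WeierstrassCurve NumberField IsDedekindDomain Field
  Literature.NumberTheory.GaloisRepresentations
  Literature.NumberTheory.EllipticCurves
  Literature.NumberTheory.EllipticCurves.ModularForms
  Literature.NumberTheory.QuadraticFields
  Literature.NumberTheory.EllipticCurves.Rank1Residual
  Literature.NumberTheory.EllipticCurves.Rank1Residual.Typed
  Literature.NumberTheory.EllipticCurves.Wuthrich2014
  Literature.NumberTheory.EllipticCurves.SteinWuthrich2013
  Literature.NumberTheory.EllipticCurves.GreenbergVatsal2000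
  Literature.NumberTheory.EllipticCurves.Disegni2020
  Summit.BirchSwinnertonDyer.Rank1Residual
  Summit.BirchSwinnertonDyer.BirchSwinnertonDyer.Theses
  Summit.BirchSwinnertonDyer.BirchSwinnertonDyer.Theorems
  Summit.BirchSwinnertonDyer.BirchSwinnertonDyer.Theorems.EisensteinPrimesMazurMCOnCellBTwistbackTwoStepDefs

namespace Summit.BirchSwinnertonDyer.BirchSwinnertonDyer.Theorems.EisensteinPrimesMazurMCOnCellBTwistbackResidualSupplies

/-! ## §1. The v11 registered stub from the two supply statements -/

/-- **SUPPLY-e ∧ SUPPLY-b ⟹ the v11 registered stub 6⁶** (statement VERBATIM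
`stub_upperPartnerOffSubrowNoConnectedClassShaUnitNoOrderOneAnchor` of twistback v11, sha256 4d01165e…). `hSe` (SUPPLY-e): every
SPLIT X2b pair `(W, p)` carries the connected Ш-unit class datum (the statement negated by the stub's third hypothesis).
`hSb` (SUPPLY-b): every NON-split X2b pair off the sub-row carries that datum OR the connected non-split order-one anchor
datum (negated by the fourth hypothesis). At a pair satisfying the stub's hypotheses both are contradicted (excluded middle on
the sign at `p`), so the conclusion holds vacuously: the stub's population is EMPTY under the supplies. Fact-free; the
supplies are HYPOTHESES — open in print; nothing is proved about them here. [cite: Wuthrich2014, Prop. 21 (p. 400)]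
[cite: Schneider1985, §1 (the conjecture; hypothesis)] -/
theorem stub66_of_supplies
    (hSe : ∀ (W : WeierstrassCurve ℚ) [W.IsElliptic] [W.IsGloballyMinimal] (p : ℕ) [Fact p.Prime],
      X2.CellB W p →
      W.HasSplitMultiplicativeReductionAtPrime p →
      (∃ (W₁ : WeierstrassCurve ℚ) (_ : W₁.IsElliptic) (_ : W₁.IsGloballyMinimal)
          (W'' : WeierstrassCurve ℚ) (_ : W''.IsElliptic) (_ : W''.IsGloballyMinimal)
          (Wc : WeierstrassCurve ℚ) (_ : Wc.IsElliptic) (_ : Wc.IsGloballyMinimal),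
          IsIsogenous W W₁ ∧
          Relation.ReflTransGen (fun A B : WeierstrassCurve ℚ ↦ TwoStepAt p A B ∨
            (TwoStepAt p B A ∧ ∃ (_ : B.IsElliptic) (_ : B.IsGloballyMinimal), X2.CellB B p)) W₁ W'' ∧
          IsIsogenous W'' Wc ∧
          ∃ q : ℚ, shaAn Wc = (q : ℂ) ∧ padicValRat p q = 0))
    (hSb : ∀ (W : WeierstrassCurve ℚ) [W.IsElliptic] [W.IsGloballyMinimal] (p : ℕ) [Fact p.Prime],
      X2.CellB W p →
      ¬ W.HasSplitMultiplicativeReductionAtPrime p →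
      ¬ (p = 3 ∧ ¬ W.HasSplitMultiplicativeReductionAtPrime 3 ∧
          ∃ (Φ₀ : AddSubgroup (geomTorsion W (3 : ℤ))) (m : ℕ) (_ : NeZero m) (φ : DirichletCharacter (ZMod 3) m)
            (d : ℕ) (_ : NeZero d) (ψ : DirichletCharacter (ZMod 3) d) (S₀ : Finset (HeightOneSpectrum (𝓞 ℚ))),
            IsRationalLine W 3 Φ₀ ∧ φ.IsPrimitive ∧ ψ.IsPrimitive ∧
            (∀ (σ : absoluteGaloisGroup ℚ), ∀ P ∈ Φ₀,
              σ • P = (φ ((modNCyclotomicCharacter ℚ m σ : (ZMod m)ˣ) : ZMod m)).val • P) ∧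
            (∀ (σ : absoluteGaloisGroup ℚ) (P : geomTorsion W (3 : ℤ)),
              σ • P - (ψ ((modNCyclotomicCharacter ℚ d σ : (ZMod d)ˣ) : ZMod d)).val • P ∈ Φ₀) ∧
            (∀ v ∈ S₀, ((3 : ℕ) : 𝓞 ℚ) ∉ v.asIdeal) ∧
            (∀ v : HeightOneSpectrum (𝓞 ℚ), v ∉ S₀ → ((3 : ℕ) : 𝓞 ℚ) ∉ v.asIdeal → W.HasGoodReductionAt v) ∧
            1 + ∑ v ∈ S₀, delta W 3 v =
              ∑ v ∈ S₀, ((if φ (Rat.HeightOneSpectrum.natGenerator v : ZMod m) =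
                    (Rat.HeightOneSpectrum.natGenerator v : ZMod 3)
                  then sFactor 3 (Rat.HeightOneSpectrum.natGenerator v) else 0) +
                (if ψ (Rat.HeightOneSpectrum.natGenerator v : ZMod d) =
                    (Rat.HeightOneSpectrum.natGenerator v : ZMod 3)
                  then sFactor 3 (Rat.HeightOneSpectrum.natGenerator v) else 0))) →
      (∃ (W₁ : WeierstrassCurve ℚ) (_ : W₁.IsElliptic) (_ : W₁.IsGloballyMinimal)
          (W'' : WeierstrassCurve ℚ) (_ : W''.IsElliptic) (_ : W''.IsGloballyMinimal)
          (Wc : WeierstrassCurve ℚ) (_ : Wc.IsElliptic) (_ : Wc.IsGloballyMinimal),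
          IsIsogenous W W₁ ∧
          Relation.ReflTransGen (fun A B : WeierstrassCurve ℚ ↦ TwoStepAt p A B ∨
            (TwoStepAt p B A ∧ ∃ (_ : B.IsElliptic) (_ : B.IsGloballyMinimal), X2.CellB B p)) W₁ W'' ∧
          IsIsogenous W'' Wc ∧
          ∃ q : ℚ, shaAn Wc = (q : ℂ) ∧ padicValRat p q = 0) ∨
      (∃ (W₁ : WeierstrassCurve ℚ) (_ : W₁.IsElliptic) (_ : W₁.IsGloballyMinimal)
          (W₀ : WeierstrassCurve ℚ) (_ : W₀.IsElliptic) (_ : W₀.IsGloballyMinimal),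
          IsIsogenous W W₁ ∧
          Relation.ReflTransGen (fun A B : WeierstrassCurve ℚ ↦ TwoStepAt p A B ∨
            (TwoStepAt p B A ∧ ∃ (_ : B.IsElliptic) (_ : B.IsGloballyMinimal), X2.CellB B p)) W₁ W₀ ∧
          ¬ W₀.HasSplitMultiplicativeReductionAtPrime p ∧
          ∃ (K : Type) (_ : Field K) (_ : NumberField K), IsImaginaryQuadratic K ∧
            SatisfiesHeegnerHypothesis (W₀.conductorNorm ℤ) K ∧ SatisfiesHeegnerHypothesis p K ∧
            Odd (NumberField.discr K) ∧ NumberField.discr K < -4 ∧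
            ∀ (Wd : WeierstrassCurve ℚ) [Wd.IsElliptic] [Wd.IsGloballyMinimal],
              (∃ C : VariableChange ℚ, C • Wd = W₀.quadraticTwist (NumberField.discr K : ℚ)) →
              ∀ {M : ℕ} [NeZero M] (f : CuspForm (Gamma0 M) 2), IsNewformOf Wd f →
              ∀ (ϖ : ℚ), (ϖ : ℝ) * Wd.realPeriodRat = plusPeriod f →
              ∀ L : PowerSeries ℚ_[p], IsMultPAdicLFunctionOf f p (-1) L → L.order = ((1 : ℕ) : ℕ∞))) :
    ∀ (W : WeierstrassCurve ℚ) [W.IsElliptic] [W.IsGloballyMinimal] (p : ℕ) [Fact p.Prime],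
      X2.CellB W p →
      ¬ (p = 3 ∧ ¬ W.HasSplitMultiplicativeReductionAtPrime 3 ∧
          ∃ (Φ₀ : AddSubgroup (geomTorsion W (3 : ℤ))) (m : ℕ) (_ : NeZero m) (φ : DirichletCharacter (ZMod 3) m)
            (d : ℕ) (_ : NeZero d) (ψ : DirichletCharacter (ZMod 3) d) (S₀ : Finset (HeightOneSpectrum (𝓞 ℚ))),
            IsRationalLine W 3 Φ₀ ∧ φ.IsPrimitive ∧ ψ.IsPrimitive ∧
            (∀ (σ : absoluteGaloisGroup ℚ), ∀ P ∈ Φ₀,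
              σ • P = (φ ((modNCyclotomicCharacter ℚ m σ : (ZMod m)ˣ) : ZMod m)).val • P) ∧
            (∀ (σ : absoluteGaloisGroup ℚ) (P : geomTorsion W (3 : ℤ)),
              σ • P - (ψ ((modNCyclotomicCharacter ℚ d σ : (ZMod d)ˣ) : ZMod d)).val • P ∈ Φ₀) ∧
            (∀ v ∈ S₀, ((3 : ℕ) : 𝓞 ℚ) ∉ v.asIdeal) ∧
            (∀ v : HeightOneSpectrum (𝓞 ℚ), v ∉ S₀ → ((3 : ℕ) : 𝓞 ℚ) ∉ v.asIdeal → W.HasGoodReductionAt v) ∧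
            1 + ∑ v ∈ S₀, delta W 3 v =
              ∑ v ∈ S₀, ((if φ (Rat.HeightOneSpectrum.natGenerator v : ZMod m) =
                    (Rat.HeightOneSpectrum.natGenerator v : ZMod 3)
                  then sFactor 3 (Rat.HeightOneSpectrum.natGenerator v) else 0) +
                (if ψ (Rat.HeightOneSpectrum.natGenerator v : ZMod d) =
                    (Rat.HeightOneSpectrum.natGenerator v : ZMod 3)
                  then sFactor 3 (Rat.HeightOneSpectrum.natGenerator v) else 0))) →
      ¬ (∃ (W₁ : WeierstrassCurve ℚ) (_ : W₁.IsElliptic) (_ : W₁.IsGloballyMinimal)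
          (W'' : WeierstrassCurve ℚ) (_ : W''.IsElliptic) (_ : W''.IsGloballyMinimal)
          (Wc : WeierstrassCurve ℚ) (_ : Wc.IsElliptic) (_ : Wc.IsGloballyMinimal),
          IsIsogenous W W₁ ∧
          Relation.ReflTransGen (fun A B : WeierstrassCurve ℚ ↦ TwoStepAt p A B ∨
            (TwoStepAt p B A ∧ ∃ (_ : B.IsElliptic) (_ : B.IsGloballyMinimal), X2.CellB B p)) W₁ W'' ∧
          IsIsogenous W'' Wc ∧
          ∃ q : ℚ, shaAn Wc = (q : ℂ) ∧ padicValRat p q = 0) →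
      ¬ (∃ (W₁ : WeierstrassCurve ℚ) (_ : W₁.IsElliptic) (_ : W₁.IsGloballyMinimal)
          (W₀ : WeierstrassCurve ℚ) (_ : W₀.IsElliptic) (_ : W₀.IsGloballyMinimal),
          IsIsogenous W W₁ ∧
          Relation.ReflTransGen (fun A B : WeierstrassCurve ℚ ↦ TwoStepAt p A B ∨
            (TwoStepAt p B A ∧ ∃ (_ : B.IsElliptic) (_ : B.IsGloballyMinimal), X2.CellB B p)) W₁ W₀ ∧
          ¬ W₀.HasSplitMultiplicativeReductionAtPrime p ∧
          ∃ (K : Type) (_ : Field K) (_ : NumberField K), IsImaginaryQuadratic K ∧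
            SatisfiesHeegnerHypothesis (W₀.conductorNorm ℤ) K ∧ SatisfiesHeegnerHypothesis p K ∧
            Odd (NumberField.discr K) ∧ NumberField.discr K < -4 ∧
            ∀ (Wd : WeierstrassCurve ℚ) [Wd.IsElliptic] [Wd.IsGloballyMinimal],
              (∃ C : VariableChange ℚ, C • Wd = W₀.quadraticTwist (NumberField.discr K : ℚ)) →
              ∀ {M : ℕ} [NeZero M] (f : CuspForm (Gamma0 M) 2), IsNewformOf Wd f →
              ∀ (ϖ : ℚ), (ϖ : ℝ) * Wd.realPeriodRat = plusPeriod f →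
              ∀ L : PowerSeries ℚ_[p], IsMultPAdicLFunctionOf f p (-1) L → L.order = ((1 : ℕ) : ℕ∞)) →
      ∃ (K : Type) (_ : Field K) (_ : NumberField K), IsImaginaryQuadratic K ∧
        SatisfiesHeegnerHypothesis (W.conductorNorm ℤ) K ∧ SatisfiesHeegnerHypothesis p K ∧
        Odd (NumberField.discr K) ∧ NumberField.discr K < -4 ∧
        (W.quadraticTwist (NumberField.discr K : ℚ)).analyticRank = 1 ∧
        ∀ (Wd : WeierstrassCurve ℚ) [Wd.IsElliptic] [Wd.IsGloballyMinimal],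
          (∃ C : VariableChange ℚ, C • Wd = W.quadraticTwist (NumberField.discr K : ℚ)) →
          MissingUpperBoundAt Wd p := by
  intro W _ _ p _ hc hsub hR hA
  by_cases hs : W.HasSplitMultiplicativeReductionAtPrime p
  · exact (hR (hSe W p hc hs)).elim
  · rcases hSb W p hc hs hsub with h | h
    · exact (hR h).elim
    · exact (hA h).elim

/-! ## §2. Crux 3 BY NAME from the named facts and the two supplies -/

/-- **CRUX 3 `MazurMCOnCellB` BY NAME from `PublishedInputs` + EIGHT PUBLISHED named facts + Keller–Yin Thm. D (PRE) + the two
SUPPLY statements** — p677789 `mazurMCOnCellB_of_namedFacts_of_upperPartnerOffSubrowNoConnectedClassShaUnitNoOrderOneAnchor`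
fed with §1. This is the class-wide residual of line `twistback` after v11 in ONE conditional theorem: besides the named facts
(PUBLISHED ×8 + item -19037; Keller–Yin Thm. D an unrefereed preprint, flag `KYD-gap`), Mazur's main conjecture on X2b needs
EXACTLY «every split X2b component (up to isogeny, in the admissible double-twist graph) contains a Ш-unit class» and «every
non-split X2b component off the sub-row contains a Ш-unit class or an order-one anchor». Both supplies are OPEN in print
(road (e): nearest Vatsal 1999 Thm. 0.3 / 2005, wrong reduction type and sign; road (b): Schneider's conjecture at one
partner, Bertrand 1982 CM only); per pair each is ONE finite reading (idea-12 ANCHOR-CENSUS-g8: 46/46 computed classes; w5/w6/w8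
kernel displays on A10 cells). CONDITIONAL; nothing about any curve is proved; BSD is not proved.
[claim: KellerYin2024, status: under-review] [cite: KellerYin2024, Thm. D = Thm. 5.1.3] [cite: Wuthrich2014, Prop. 21 (p. 400)]
[cite: Disegni2020, §2.2 Thm. 2.4 and §3.2 Thm. 4] [cite: GreenbergVatsal2000, §3 Thm. (3.11)] [cite: Schneider1985, §1 (hypothesis)]
[cite: Miller2011LMS, Def. 1.1] -/
theorem mazurMCOnCellB_of_namedFacts_of_supplies
    (hP : EisensteinPrimes.PublishedInputs) (hW21 : sha_dvd_analyticSha)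
    (hDis : padicBSD_rankOne_nonsplitMult) (hMaz : mazur_not_dvd_maninConstant_of_odd)
    (hH : hsieh2014_exists_anticyclotomicPAdicLFunction) (hF : LiuZhangZhang2018.thm151_thm153_modularCurve_heegnerVector)
    (h311 : thm311_hasUnitContent_iff_and_order_eq_of_lineRamifiedEven)
    (hDGZ : Disegni2020.padicGrossZagier_nonsplitMult)
    (hNHT : Literature.NumberTheory.QuadraticFields.nakagawaHorie_taya_exists_imaginary_h3_eq_one)
    (hD : KellerYin2024.thmD_imcMult_exists_isBDPLFunction_isTorsion_charIdeal_eq_OPEN)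
    (hSe : ∀ (W : WeierstrassCurve ℚ) [W.IsElliptic] [W.IsGloballyMinimal] (p : ℕ) [Fact p.Prime],
      X2.CellB W p →
      W.HasSplitMultiplicativeReductionAtPrime p →
      (∃ (W₁ : WeierstrassCurve ℚ) (_ : W₁.IsElliptic) (_ : W₁.IsGloballyMinimal)
          (W'' : WeierstrassCurve ℚ) (_ : W''.IsElliptic) (_ : W''.IsGloballyMinimal)
          (Wc : WeierstrassCurve ℚ) (_ : Wc.IsElliptic) (_ : Wc.IsGloballyMinimal),
          IsIsogenous W W₁ ∧
          Relation.ReflTransGen (fun A B : WeierstrassCurve ℚ ↦ TwoStepAt p A B ∨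
            (TwoStepAt p B A ∧ ∃ (_ : B.IsElliptic) (_ : B.IsGloballyMinimal), X2.CellB B p)) W₁ W'' ∧
          IsIsogenous W'' Wc ∧
          ∃ q : ℚ, shaAn Wc = (q : ℂ) ∧ padicValRat p q = 0))
    (hSb : ∀ (W : WeierstrassCurve ℚ) [W.IsElliptic] [W.IsGloballyMinimal] (p : ℕ) [Fact p.Prime],
      X2.CellB W p →
      ¬ W.HasSplitMultiplicativeReductionAtPrime p →
      ¬ (p = 3 ∧ ¬ W.HasSplitMultiplicativeReductionAtPrime 3 ∧
          ∃ (Φ₀ : AddSubgroup (geomTorsion W (3 : ℤ))) (m : ℕ) (_ : NeZero m) (φ : DirichletCharacter (ZMod 3) m)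
            (d : ℕ) (_ : NeZero d) (ψ : DirichletCharacter (ZMod 3) d) (S₀ : Finset (HeightOneSpectrum (𝓞 ℚ))),
            IsRationalLine W 3 Φ₀ ∧ φ.IsPrimitive ∧ ψ.IsPrimitive ∧
            (∀ (σ : absoluteGaloisGroup ℚ), ∀ P ∈ Φ₀,
              σ • P = (φ ((modNCyclotomicCharacter ℚ m σ : (ZMod m)ˣ) : ZMod m)).val • P) ∧
            (∀ (σ : absoluteGaloisGroup ℚ) (P : geomTorsion W (3 : ℤ)),
              σ • P - (ψ ((modNCyclotomicCharacter ℚ d σ : (ZMod d)ˣ) : ZMod d)).val • P ∈ Φ₀) ∧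
            (∀ v ∈ S₀, ((3 : ℕ) : 𝓞 ℚ) ∉ v.asIdeal) ∧
            (∀ v : HeightOneSpectrum (𝓞 ℚ), v ∉ S₀ → ((3 : ℕ) : 𝓞 ℚ) ∉ v.asIdeal → W.HasGoodReductionAt v) ∧
            1 + ∑ v ∈ S₀, delta W 3 v =
              ∑ v ∈ S₀, ((if φ (Rat.HeightOneSpectrum.natGenerator v : ZMod m) =
                    (Rat.HeightOneSpectrum.natGenerator v : ZMod 3)
                  then sFactor 3 (Rat.HeightOneSpectrum.natGenerator v) else 0) +
                (if ψ (Rat.HeightOneSpectrum.natGenerator v : ZMod d) =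
                    (Rat.HeightOneSpectrum.natGenerator v : ZMod 3)
                  then sFactor 3 (Rat.HeightOneSpectrum.natGenerator v) else 0))) →
      (∃ (W₁ : WeierstrassCurve ℚ) (_ : W₁.IsElliptic) (_ : W₁.IsGloballyMinimal)
          (W'' : WeierstrassCurve ℚ) (_ : W''.IsElliptic) (_ : W''.IsGloballyMinimal)
          (Wc : WeierstrassCurve ℚ) (_ : Wc.IsElliptic) (_ : Wc.IsGloballyMinimal),
          IsIsogenous W W₁ ∧
          Relation.ReflTransGen (fun A B : WeierstrassCurve ℚ ↦ TwoStepAt p A B ∨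
            (TwoStepAt p B A ∧ ∃ (_ : B.IsElliptic) (_ : B.IsGloballyMinimal), X2.CellB B p)) W₁ W'' ∧
          IsIsogenous W'' Wc ∧
          ∃ q : ℚ, shaAn Wc = (q : ℂ) ∧ padicValRat p q = 0) ∨
      (∃ (W₁ : WeierstrassCurve ℚ) (_ : W₁.IsElliptic) (_ : W₁.IsGloballyMinimal)
          (W₀ : WeierstrassCurve ℚ) (_ : W₀.IsElliptic) (_ : W₀.IsGloballyMinimal),
          IsIsogenous W W₁ ∧
          Relation.ReflTransGen (fun A B : WeierstrassCurve ℚ ↦ TwoStepAt p A B ∨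
            (TwoStepAt p B A ∧ ∃ (_ : B.IsElliptic) (_ : B.IsGloballyMinimal), X2.CellB B p)) W₁ W₀ ∧
          ¬ W₀.HasSplitMultiplicativeReductionAtPrime p ∧
          ∃ (K : Type) (_ : Field K) (_ : NumberField K), IsImaginaryQuadratic K ∧
            SatisfiesHeegnerHypothesis (W₀.conductorNorm ℤ) K ∧ SatisfiesHeegnerHypothesis p K ∧
            Odd (NumberField.discr K) ∧ NumberField.discr K < -4 ∧
            ∀ (Wd : WeierstrassCurve ℚ) [Wd.IsElliptic] [Wd.IsGloballyMinimal],
              (∃ C : VariableChange ℚ, C • Wd = W₀.quadraticTwist (NumberField.discr K : ℚ)) →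
              ∀ {M : ℕ} [NeZero M] (f : CuspForm (Gamma0 M) 2), IsNewformOf Wd f →
              ∀ (ϖ : ℚ), (ϖ : ℝ) * Wd.realPeriodRat = plusPeriod f →
              ∀ L : PowerSeries ℚ_[p], IsMultPAdicLFunctionOf f p (-1) L → L.order = ((1 : ℕ) : ℕ∞))) :
    Summit.BirchSwinnertonDyer.BirchSwinnertonDyer.Theses.EisensteinPrimes.MazurMCOnCellB :=
  EisensteinPrimesMazurMCOnCellBOfNamedFactsV11.mazurMCOnCellB_of_namedFacts_of_upperPartnerOffSubrowNoConnectedClassShaUnitNoOrderOneAnchor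
    hP hW21 hDis hMaz hH hF h311 hDGZ hNHT hD (stub66_of_supplies hSe hSb)

end Summit.BirchSwinnertonDyer.BirchSwinnertonDyer.Theorems.EisensteinPrimesMazurMCOnCellBTwistbackResidualSupplies

end
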